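import Summits.QuantumAdvantage.QuantumAdvantage.Theorems.MobiusLadderLiouvilleNotPPolyOneTimePad
import Summits.QuantumAdvantage.QuantumAdvantage.Theorems.MobiusLadderLiouvilleNotPPolyPadOracle
import Summits.QuantumAdvantage.QuantumAdvantage.Theorems.MobiusLadderLiouvilleNotPPolyMildAvgHardOfApex
import Summits.QuantumAdvantage.QuantumAdvantage.Theorems.MobiusLadderLiouvilleNotPPolySubexpTightness
import Summits.QuantumAdvantage.QuantumAdvantage.Theorems.MobiusLadderLiouvilleNotPPolyMulConstCircuit
import Summits.QuantumAdvantage.QuantumAdvantage.Theorems.MobiusLadderLiouvilleNotPPolyHardcoreInstances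
import Summits.QuantumAdvantage.QuantumAdvantage.Theorems.MobiusLadderLiouvilleNotPPolySelfAmplification
import Summits.QuantumAdvantage.QuantumAdvantage.Theorems.MobiusLadderLiouvilleNotPPolyFactoringAvgHard
import HarnessLib

/-!
# Crux `MobiusLadder.LiouvilleNotPPoly` (stmt-QuantumAdvantage-1389) — line `SketchIdeator4`
# (idea `multiplicative-one-time-pad`), lead c4: CHECKED SKELETON v3 — closed modulo `stub_apex`

`X := L_λ ∉ P/poly` (`Summit.QuantumAdvantage.QuantumAdvantage.Theses.MobiusLadder.LiouvilleNotPPoly`).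

v3 (lead c4, after wave 1): every EARNED stub of the line is a tree theorem and is IMPORTED here —

* Defs p126095 (`…OneTimePadDefs`: `liouvilleLang`, `errCount`, `RareErrorFamily`, `padOracle`,
  `disagree`, `MildAvgHard`, `corr`, `LiouvilleOrthogonalPPoly`, `prodCorr`, `flipAt`, `CloseAtRate`,
  `crux_iff`);
* kernel p126947 (`…OneTimePad`: pad identity, counting kernel, T1′ `stub_ceiling`, `decides_eval`,
  `liouvilleLang_not_mem_PPoly_of_apex`, `liouvilleLang_not_mem_PPoly_of_mildAvgHard`);
* link p126581 (`stub_mildAvgHard_of_apex : LiouvilleOrthogonalPPoly → MildAvgHard 1`);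
* T1a p126926 (`stub_padOracle`), T1b p127666 (`stub_subexpTightness`);
* T2a p127564 (`stub_mulConstCircuit`), T2b p128067 (`stub_hardcoreInstances`),
  T2c p127711 (`stub_selfAmplification`);
* T3′ p127829 (`stub_factoringAvgHard`).

What remains is the ONE registered stub the composition uses:

* §S  `stub_apex : LiouvilleOrthogonalPPoly` — the apex `C⁺` (Möbius randomness at polynomial size),
      hypothesis-type: `C⁺ ⇒ MildAvgHard 1 ⇒ X ⇒ NP ⊄ P/poly` (link p126581, Composition 2 p126947,
      Strength p117096); held by the lead, never staffed.
* §C  the composition `LiouvilleNotPPoly_of : Theses.MobiusLadder.LiouvilleNotPPoly` (uses `stub_apex`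
      only) and the now sorry-free corollaries tying the earned stubs to the crux.

`lean check`: rc 0, sorries exactly 1 (`stub_apex`).
-/

set_option linter.dupNamespace false -- D-0017: single-problem summit ⇒ `QuantumAdvantage.QuantumAdvantage` by design

noncomputable section

namespace Summit.QuantumAdvantage.QuantumAdvantage.Theorems.LiouvilleNotPPoly.OneTimePad

open Literature.Computability.Complexity
open Literature.Probability.RandomGraphs.LowDegree (sgn sgn_true sgn_false)
open _root_.Computability Filter Finset Polynomial
open Summit.QuantumAdvantage.QuantumAdvantage.Theorems.MobiusLadder
open Summit.QuantumAdvantage.QuantumAdvantage.Theorems.LiouvilleOrthogonalTC0 (bits ofBits lamBit)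

/-! ## §S The registered stubs (one left) -/

/-- **STUB (apex, lead) · `stub_apex` — Möbius randomness at polynomial size, `C⁺`.** Hypothesis-type
(`C⁺ ⇒ MildAvgHard 1 ⇒ X ⇒ NP ⊄ P/poly`); the one stub the composition uses. -/
theorem stub_apex : LiouvilleOrthogonalPPoly := by
  sorry

/-! ## §C Composition into the crux BY NAME, and the corollaries of the earned stubs -/

/-- **THE LINE'S THEOREM.** The apex `C⁺` (stub) concludes the crux
`Summit.QuantumAdvantage.QuantumAdvantage.Theses.MobiusLadder.LiouvilleNotPPoly` by name. -/
theorem LiouvilleNotPPoly_of : Theses.MobiusLadder.LiouvilleNotPPoly :=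
  liouvilleLang_not_mem_PPoly_of_apex stub_apex

/-- The ladder is linear: `C⁺ ⇒ MildAvgHard 1 ⇒ X` (landed link p126581 + Composition 2). -/
theorem liouvilleLang_not_mem_PPoly_of_apex' (H : LiouvilleOrthogonalPPoly) :
    liouvilleLang ∉ PPoly :=
  liouvilleLang_not_mem_PPoly_of_mildAvgHard (stub_mildAvgHard_of_apex H)

/-- **T1 assembled (T1a p126926 + T1b p127666): subexponential-error tightness** — a `P/poly`
language with error `≤ 2^{ℓ-ℓ^ε}/16` at every large length already puts `L_λ` in `P/poly`. -/
theorem subexpTightness {ε : ℝ} (hε : 0 < ε) (hε1 : ε ≤ 1) (hR : RareErrorFamily ε) :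
    liouvilleLang ∈ PPoly :=
  stub_subexpTightness stub_padOracle ε hε hε1 hR

/-- **Corollary of T1 (sorry-free): the crux is EQUIVALENT to the absence of rare-error families** —
`X` is itself a (very mild) average-case statement; a refutation needs only a `2^{-ℓ^ε}`-error family. -/
theorem crux_iff_noRareError {ε : ℝ} (hε : 0 < ε) (hε1 : ε ≤ 1) :
    Theses.MobiusLadder.LiouvilleNotPPoly ↔ ¬ RareErrorFamily ε :=
  ⟨fun hX hR => hX (subexpTightness hε hε1 hR), fun hR hmem => hR (rareErrorFamily_of_mem_PPoly hmem ε)⟩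

/-- **T2 assembled (T2a p127564 + T2b p128067 + T2c p127711, sorry-free): XOR self-amplification on
Kalai products** — `MildAvgHard c` forces vanishing correlation of every polynomial-size circuit with
`λ` on products of `k(n) = poly(n)` independent `n`-bit instances. -/
theorem selfAmplification (c : ℕ) (H : MildAvgHard c) (p : Polynomial ℕ) {ε : ℝ} (hε : 0 < ε) :
    ∃ k : ℕ → ℕ, (∃ d : ℕ, ∀ n, k n ≤ n ^ d + d) ∧ (∀ n, 1 ≤ k n) ∧
      ∀ᶠ n : ℕ in atTop, ∀ C : Circuit (Fin (k n * n)), C.IsOver B2 →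
        C.size ≤ p.eval (k n * n) → |prodCorr n (k n) C| ≤ ε :=
  stub_selfAmplification stub_mulConstCircuit stub_hardcoreInstances c H p ε hε

/-- **Corollary of T3′ under the apex (sorry-free given `H`)**: `C⁺` makes factoring `1/n`-hard on
average for polynomial-size circuits (link p126581 + T3′ p127829). -/
theorem factoringAvgHard_of_apex (H : LiouvilleOrthogonalPPoly) (p : Polynomial ℕ) :
    ∀ᶠ n : ℕ in atTop, ∀ F : (Fin n → Bool) → Fin n × Fin n → Bool, CktSize B2 F (p.eval n) →
      (n : ℝ) ^ 1 *
          (((Finset.Ico (2 ^ (n - 1)) (2 ^ n)).filter fun N =>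
              ((List.ofFn fun i : Fin n => ofBits fun j : Fin n => F (bits n N) (i, j)).filter
                  (· ≠ 0)).Perm N.primeFactorsList).card : ℝ) ≤
        ((n : ℝ) ^ 1 - 1) * (2 : ℝ) ^ (n - 1) :=
  stub_factoringAvgHard 1 (stub_mildAvgHard_of_apex H) p

/-- **Corollary of T2 under the apex (sorry-free given `H`)**: `C⁺` gives vanishing correlation with
`λ` on the Kalai product ensembles at polynomial size (link p126581 + T2) — a conditional Chowla-type
statement internal to `λ`. -/
theorem selfAmplification_of_apex (H : LiouvilleOrthogonalPPoly) (p : Polynomial ℕ) {ε : ℝ}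
    (hε : 0 < ε) :
    ∃ k : ℕ → ℕ, (∃ d : ℕ, ∀ n, k n ≤ n ^ d + d) ∧ (∀ n, 1 ≤ k n) ∧
      ∀ᶠ n : ℕ in atTop, ∀ C : Circuit (Fin (k n * n)), C.IsOver B2 →
        C.size ≤ p.eval (k n * n) → |prodCorr n (k n) C| ≤ ε :=
  selfAmplification 1 (stub_mildAvgHard_of_apex H) p hε

end Summit.QuantumAdvantage.QuantumAdvantage.Theorems.LiouvilleNotPPoly.OneTimePad

end
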